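import Summits.ResolutionOfSingularities.ResolutionOfSingularities.Theorems.FrobeniusLadderFInjectiveMacaulayficationFiModelOfCharts
import Literature.AlgebraicGeometry.Resolution.BlowupsExistence
import HarnessLib

/-!
# Crux `FInjectiveMacaulayfication`: the TOWER STEP — blowing up a centre co-supported at one closed point with
certified charts yields an F-injective Macaulayfication (line `Sketch`, cycle 7, T2′)

Support file for crux `stmt-ResolutionOfSingularities-15315` (`FrobeniusLadder.FInjectiveMacaulayfication`, route
`ResolutionOfSingularities/FrobeniusLadder`, rung 2), line `Sketch`, registered stub
`stub_fiModelOfPointSupportedCentre` (wave 1 of cycle 7, seat c6).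

The corollary of the ENGINE INTERFACE `FiModelOfCharts.stub_fiModelOfCharts` used to iterate blow-ups (towers) on a
possibly non-affine intermediate model. Let `X₁` be integral and locally Noetherian, `b ∈ X₁` a closed point, and `J`
an ideal sheaf with `supp J = {b}` which is the unit ideal on every affine open missing `b`. Fix an affine open `U ∋ b`
with `J(U) ≠ 0`. Suppose every non-empty affine open has sections of characteristic `p`, the local rings of `X₁` at
the points `x ≠ b` already satisfy the crux's stalk clause (domain; systems of parameters weakly regular; parameter
ideals Frobenius closed), and `J(U)` has generators `x₁, …, x_r` whose chart rings `Γ(U)[J(U)/xᵢ]` (`xᵢ ≠ 0`) satisfy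
the Cohen–Macaulay + Frobenius-closed clause at their maximal ideals containing `xᵢ/1`. Then there is a proper
birational `π : X' → X₁` with `X'` integral all of whose stalks satisfy the full clause.

Proof: take for `π` a blowing up of `X₁` along `J` (`exists_isBlowup`, Görtz–Wedhorn I, Prop. 13.92); `J ≠ ⊥` as
`J(U) ≠ 0`; off `supp J = {b}` the clause is the hypothesis; and the engine interface is fed the affine cover
`{U} ∪ {V affine open | b ∉ V, V ≠ ∅}` (a cover since `{b}ᶜ` is open and the affine opens form a basis): on `U` the
given chart data, on such `V` the single generator `1` of `J(V) = Γ(V)` (a non-zero ring), whose chart condition is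
vacuous because `1/1 = 1` lies in no maximal ideal.

References: U. Görtz, T. Wedhorn, *Algebraic Geometry I*, Def. 13.90, Prop. 13.91, 13.92; The Stacks Project, Tags
0804, 01OG, 02OS. [folklore]
-/

-- single-problem summit: the doubled namespace component is forced
set_option linter.dupNamespace false

noncomputable section

namespace Summit.ResolutionOfSingularities.ResolutionOfSingularities.Theorems.FInjectiveMacaulayfication.FiModelOfPointSupportedCentre

open AlgebraicGeometry CategoryTheory Literature.AlgebraicGeometry.Resolution

/-- **THE TOWER STEP** (registered stub `stub_fiModelOfPointSupportedCentre`): on an integral locally Noetherian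
scheme `X₁` with a closed point `b`, an ideal sheaf `J` with `supp J = {b}`, equal to the unit ideal on the affine opens
missing `b`, non-zero on an affine open `U ∋ b` where it is generated by `x₁, …, x_r` with certified chart rings
`Γ(U)[J(U)/xᵢ]` (Cohen–Macaulay + Frobenius-closed clause at the maximal ideals containing `xᵢ/1`), such that the
non-empty affine opens have sections of characteristic `p` and the stalks at the points `x ≠ b` satisfy the full
clause, admits a proper birational model `π : X' → X₁` (a blowing up along `J`) with `X'` integral all of whose
stalks satisfy the full clause. [folklore] -/
theorem stub_fiModelOfPointSupportedCentre : ∀ (p : ℕ) [Fact p.Prime] (X₁ : Scheme.{0}) [IsIntegral X₁]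
    [IsLocallyNoetherian X₁] (b : X₁), IsClosed ({b} : Set X₁) →
    ∀ (J : X₁.IdealSheafData), (J.support : Set X₁) = {b} →
    (∀ V : X₁.affineOpens, b ∉ (V : X₁.Opens) → J.ideal V = ⊤) →
    ∀ (U : X₁.affineOpens), b ∈ (U : X₁.Opens) → J.ideal U ≠ ⊥ →
    (∀ V : X₁.affineOpens, ((V : X₁.Opens) : Set X₁).Nonempty → CharP Γ(X₁, V) p) →
    (∀ x : X₁, x ≠ b →
      IsDomain (X₁.presheaf.stalk x) ∧ ∀ d : ℕ, ringKrullDim (X₁.presheaf.stalk x) = d →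
        ∀ s : Fin d → X₁.presheaf.stalk x, (Ideal.span (Set.range s)).radical.IsMaximal →
          RingTheory.Sequence.IsWeaklyRegular (X₁.presheaf.stalk x) (List.ofFn s) ∧
          ∀ y : X₁.presheaf.stalk x, (∃ e : ℕ, y ^ p ^ e ∈ Ideal.span
            ((fun z : X₁.presheaf.stalk x => z ^ p ^ e) ''
              (Ideal.span (Set.range s) : Set (X₁.presheaf.stalk x)))) → y ∈ Ideal.span (Set.range s)) →
    (∃ (r : ℕ) (x : Fin r → Γ(X₁, U)) (hxI : ∀ i, x i ∈ J.ideal U), Ideal.span (Set.range x) = J.ideal U ∧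
        ∀ (i : Fin r), x i ≠ 0 →
          ∀ (Q : Ideal (HomogeneousLocalization.Away (reesGrading (J.ideal U)) (reesT (x i) (hxI i)))) [Q.IsMaximal],
          reesChartBase (x i) (hxI i) (x i) ∈ Q →
          ∀ d : ℕ, ringKrullDim (Localization.AtPrime Q) = d → ∀ s : Fin d → Localization.AtPrime Q,
            (Ideal.span (Set.range s)).radical.IsMaximal →
              RingTheory.Sequence.IsWeaklyRegular (Localization.AtPrime Q) (List.ofFn s) ∧
              ∀ y : Localization.AtPrime Q, (∃ e : ℕ, y ^ p ^ e ∈ Ideal.span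
                ((fun z : Localization.AtPrime Q => z ^ p ^ e) ''
                  (Ideal.span (Set.range s) : Set (Localization.AtPrime Q)))) → y ∈ Ideal.span (Set.range s)) →
    ∃ (X' : Scheme.{0}) (π : X' ⟶ X₁), IsProper π ∧ Literature.AlgebraicGeometry.Resolution.IsBirational π ∧
      IsIntegral X' ∧
      ∀ x : X', IsDomain (X'.presheaf.stalk x) ∧ ∀ d : ℕ, ringKrullDim (X'.presheaf.stalk x) = d →
        ∀ s : Fin d → X'.presheaf.stalk x, (Ideal.span (Set.range s)).radical.IsMaximal →
          RingTheory.Sequence.IsWeaklyRegular (X'.presheaf.stalk x) (List.ofFn s) ∧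
          ∀ z : X'.presheaf.stalk x, (∃ e : ℕ, z ^ p ^ e ∈
              Ideal.span ((fun w : X'.presheaf.stalk x => w ^ p ^ e) ''
                (Ideal.span (Set.range s) : Set (X'.presheaf.stalk x)))) →
            z ∈ Ideal.span (Set.range s) := by
  intro p _ X₁ _ _ b hb J hJsupp hJtop U hbU hJU hchar hoff hon
  -- a blowing up of `X₁` along `J` (Görtz–Wedhorn I, Prop. 13.92)
  obtain ⟨X', π, hπ⟩ := exists_isBlowup X₁ J
  -- `J ≠ ⊥` since `J(U) ≠ 0`
  have hJ : J ≠ ⊥ := fun h => hJU (by rw [h, Scheme.IdealSheafData.ideal_bot, Pi.bot_apply])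
  -- the affine cover `{U} ∪ {V | b ∉ V, V ≠ ∅}` fed to the engine interface
  have hS : ∀ x : X₁, ∃ V ∈ insert U {V : X₁.affineOpens | b ∉ (V : X₁.Opens) ∧
      ((V : X₁.Opens) : Set X₁).Nonempty}, x ∈ (V : X₁.Opens) := by
    intro x
    rcases eq_or_ne x b with rfl | hx
    · exact ⟨U, Set.mem_insert _ _, hbU⟩
    · -- `{b}ᶜ` is an open neighbourhood of `x`; the affine opens form a basis
      obtain ⟨_, ⟨W, hW, rfl⟩, hxW, hWb⟩ := X₁.isBasis_affineOpens.exists_subset_of_mem_open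
        (Set.mem_compl_singleton_iff.mpr hx) hb.isOpen_compl
      have hbW : b ∉ W := fun h => Set.mem_compl_singleton_iff.mp (hWb h) rfl
      exact ⟨⟨W, hW⟩, Set.mem_insert_of_mem _ ⟨hbW, x, hxW⟩, hxW⟩
  refine ⟨X', π, FiModelOfCharts.stub_fiModelOfCharts p X₁ X' J π hJ hπ (fun x hx => hoff x ?_) _ hS
    (Set.forall_mem_insert.mpr ⟨⟨hchar _ ⟨b, hbU⟩, hJU, hon⟩, ?_⟩)⟩
  · -- off the centre: `x ∉ supp J = {b}` iff `x ≠ b`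
    rw [hJsupp] at hx
    exact fun h => hx (h ▸ Set.mem_singleton x)
  · -- an affine open `V ∌ b`, `V ≠ ∅`: `J(V) = Γ(V) ≠ 0` is generated by `1`; vacuous chart condition
    intro V hV
    have hV' : b ∉ (V : X₁.Opens) ∧ ((V : X₁.Opens) : Set X₁).Nonempty := hV
    obtain ⟨hbV, hVne⟩ := hV'
    have hJV : J.ideal V = ⊤ := hJtop V hbV
    haveI : Nonempty (V : X₁.Opens) := by
      obtain ⟨y, hy⟩ := hVne
      exact ⟨⟨y, hy⟩⟩
    have h1V : (1 : Γ(X₁, V)) ∈ J.ideal V := by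
      rw [hJV]
      exact Submodule.mem_top
    refine ⟨hchar V hVne, ?_, 1, fun _ => 1, fun _ => h1V, ?_, ?_⟩
    · rw [hJV]
      exact top_ne_bot
    · rw [hJV, Ideal.eq_top_iff_one]
      exact Ideal.subset_span ⟨0, rfl⟩
    · intro i _ Q hQ h1
      rw [map_one] at h1
      exact (hQ.ne_top ((Ideal.eq_top_iff_one Q).mpr h1)).elim

end Summit.ResolutionOfSingularities.ResolutionOfSingularities.Theorems.FInjectiveMacaulayfication.FiModelOfPointSupportedCentre

end
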